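import Summits.ResolutionOfSingularities.ResolutionOfSingularities.Theorems.WeightedInvariantP3bDrop
import HarnessLib

/-!
# `J₃` OF RECORD for the P3 rung: `Iota3.jFlat := jCylinder iotaOrdEps jFlatCore` — the point rule `jSigmaPt` (sup over the σ-attaining
# flags), the dimension switch `jFlatCore` (P≤2: `jContact`; dim 3: `jSigmaPt`), read through the cylinder over the top `(ν;ε)`-stratum
# (door `HypersurfaceCentreConstruction`, stmt-ResolutionOfSingularities-19897; KEY `stub_localWeightedDropEFT4S`; P3 rung `stub_keyRung_dimLEThree`,
# skeleton v3.7 / ladder `PRung d` p522114; ORDER (o37) «J₃ OF RECORD» of res-L1-w43-plan-1, DEALS gen 11 #1 (1); typer res-type-061)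

Topic: `Summits/ResolutionOfSingularities/ResolutionOfSingularities/Theorems`. DEFINITIONS posited by the route `WeightedInvariant` for the door
item `HypersurfaceCentreConstruction` (`--supports stmt-ResolutionOfSingularities-19897 --as helper`) — objects OF THE LINE (IOTA3-DESIGN v1.2
§3 / §5), not cited statements — and their TRANSPORT:

* `Iota3.IsPrimitiveTriple q r₁ r₂` — no common divisor (the reduced weight vector; excludes res-L1-w43-tri-2's weight-scaling twins).
* `Iota3.jSigmaPtLocal f m` / **`Iota3.jSigmaPt R f m`** — the POINT RULE: uniform junk first (`0 ↦ ⊥`, units `↦ ⊤`, as `jContact` (R4)),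
  then the CHOICE-FREE sup `⨆ flagContactFiltration g₁ g₂ q r₁ r₂ m` over the σ-ATTAINING two-flags `(g₁, g₂; q, r₁, r₂)` of `f`
  (`IsSigmaMaximiser f (ord f) …`, p529577) with PRIMITIVE weights; `⊤` off local rings.  Equals the filtration of ANY single attaining flag
  under the canonicity obligation (J-can) of the memo — NOT assumed here (the sup is what is typed).
* **`Iota3.jFlatCore R f m`** — the DIMENSION SWITCH: `jContact R f m` (res-type-092's closed P1 ∪ P2 rule, p514802) when `ringKrullDim R ≤ 2`,
  `jSigmaPt R f m` otherwise.
* **`Iota3.jFlat := ContactCylinder.jCylinder iotaOrdEps jFlatCore`** — `J₃` OF RECORD: `jFlatCore` READ AT THE GENERIC POINT `P₀` of the top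
  `(ν;ε)`-stratum (res-type-005's cylinder construction p524206 over res-type-013's letters p527087): at P3a / divisorial positions
  (`dim R_{P₀} ≤ 2`) it is the CYLINDER over `jContact (R_{P₀}) (f/1)` (`jFlat_eq_cylinderAt_jContact`); at point-centre positions of dimension 3
  (`P₀ = 𝔪`) it is `jSigmaPt R f` (`jFlat_eq_jSigmaPt`); at positions of dimension ≤ 2 with `P₀ = 𝔪` it is `jContact R f` (`jFlat_eq_jContact`).
* TRANSPORT: `jSigmaPt_isoInvariant` / `jSigmaPt_unitInvariant`, `jFlatCore_isoInvariant` / `jFlatCore_unitInvariant`, and — by res-type-061's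
  `jCylinder_isoInvariant` / `jCylinder_unitInvariant` (p527090) — **`jFlat_isoInvariant : JIsoInvariant jFlat`**, **`jFlat_unitInvariant :
  JUnitInvariant jFlat`**: the conjuncts (c5) / (c12-J) of `PRung 3 p iotaFlat jFlat`.
* (adm)-shape memberships: `flagContactFiltration_le_jSigmaPt`, `mem_jSigmaPt_level` (an attaining flag's level-`r₁ν` piece contains `f`).

[OURS · candidates · objects of a conjecture-grade rung of OUR key; nothing here asserts anything about Hironaka's problem; NOT a statement of the
manuscript under review (Hironaka 2017, [claim: Hironaka2017, status: under-review]); AI typing, weaker than expert review.]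

## References
* D. Abramovich, M. Temkin, J. Włodarczyk, *Functorial embedded resolution via weighted blowings up*, Algebra & Number Theory 18 (2024), §5
  (the centre `(x₁^{a₁}, …, xₙ^{aₙ})` attached to the invariant). [AbramovichTemkinWlodarczyk2024]
* res-L1-w43-plan-1, `L/res-L1-w43-plan-1/IOTA3-DESIGN.md` v1.2 (OURS, AI planning).
-/

noncomputable section

open IsLocalRing Literature.AlgebraicGeometry.Resolution
open Summit.ResolutionOfSingularities.ResolutionOfSingularities.Theorems

set_option linter.dupNamespace false -- mandated namespace of this single-conjunct summit

namespace Summit.ResolutionOfSingularities.ResolutionOfSingularities.Cruxes.HypersurfaceCentreConstruction.LocalEngine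

namespace Iota3

variable {S : Type} [CommRing S]

/-! ## Definitions -/

/-- [OURS · (o37)] A weight triple `(q; r₁, r₂)` is **primitive**: no common divisor `> 1` (the reduced centre; weight-scaling twins excluded).
A predicate of the line, not a cited statement. -/
def IsPrimitiveTriple (q r₁ r₂ : ℕ) : Prop :=
  ∀ d : ℕ, d ∣ q → d ∣ r₁ → d ∣ r₂ → d = 1

open Classical in
/-- [OURS · (o37)] **The point rule at a local ring**: uniform junk first (`0 ↦ ⊥`, units `↦ ⊤`), then the choice-free sup of the two-flag
filtrations `flagContactFiltration g₁ g₂ q r₁ r₂ m` over all σ-ATTAINING two-flags of `f` (`IsSigmaMaximiser f (ord f) g₁ g₂ q r₁ r₂`) with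
PRIMITIVE weights.  Candidate object of the line (IOTA3-DESIGN v1.2 §3 P3b «exact flag weights at isolated points»). -/
def jSigmaPtLocal [IsLocalRing S] (f : S) (m : ℕ) : Ideal S :=
  if f = 0 then ⊥
  else if IsUnit f then ⊤
  else ⨆ (g₁ : S) (g₂ : S) (q : ℕ) (r₁ : ℕ) (r₂ : ℕ)
    (_ : IsSigmaMaximiser f (adicOrder f).toNat g₁ g₂ q r₁ r₂ ∧ IsPrimitiveTriple q r₁ r₂),
      flagContactFiltration g₁ g₂ q r₁ r₂ m

open Classical in
/-- [OURS · (o37) · candidate] **The point rule `jSigmaPt`** in the binder shape `(R : Type) → [CommRing R] → R → ℕ → Ideal R` of the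
clauses: `jSigmaPtLocal` on local rings, `⊤` off local rings (junk, as `jContact`). -/
def jSigmaPt (R : Type) [CommRing R] (f : R) (m : ℕ) : Ideal R :=
  if h : IsLocalRing R then @jSigmaPtLocal R _ h f m else ⊤

open Classical in
/-- [OURS · (o37) · candidate] **The dimension switch `jFlatCore`**: the closed rule `jContact` of the rungs P1 ∪ P2 (res-type-092, p514802) at
rings of Krull dimension `≤ 2`, the point rule `jSigmaPt` otherwise. -/
def jFlatCore (R : Type) [CommRing R] (f : R) (m : ℕ) : Ideal R :=
  if ringKrullDim R ≤ 2 then jContact R f m else jSigmaPt R f m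

/-- [OURS · (o37) · candidate] **`J₃` OF RECORD**: `jFlat := jCylinder iotaOrdEps jFlatCore` — the dimension-switched rule READ AT THE GENERIC
POINT of the top `(ν;ε)`-stratum (res-type-005's `ContactCylinder.jCylinder`, p524206; res-type-013's `iotaOrdEps`, p527087).  The P3 pair of
record is `(iotaFlat, jFlat)` (IOTA3-DESIGN v1.2). -/
def jFlat : (R : Type) → [CommRing R] → R → ℕ → Ideal R :=
  ContactCylinder.jCylinder iotaOrdEps jFlatCore

/-! ## Unfolding lemmas -/

/-- Junk: `jSigmaPtLocal 0 m = ⊥`. [folklore] -/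
theorem jSigmaPtLocal_zero [IsLocalRing S] (m : ℕ) : jSigmaPtLocal (0 : S) m = ⊥ := by
  unfold jSigmaPtLocal
  rw [if_pos rfl]

/-- Junk: `jSigmaPtLocal f m = ⊤` for a unit `f`. [folklore] -/
theorem jSigmaPtLocal_of_isUnit [IsLocalRing S] {f : S} (hf : IsUnit f) (m : ℕ) : jSigmaPtLocal f m = ⊤ := by
  unfold jSigmaPtLocal
  rw [if_neg hf.ne_zero, if_pos hf]

/-- The sup branch (non-zero non-unit). [folklore] -/
theorem jSigmaPtLocal_of_ne [IsLocalRing S] {f : S} (hf0 : f ≠ 0) (hfu : ¬ IsUnit f) (m : ℕ) :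
    jSigmaPtLocal f m = ⨆ (g₁ : S) (g₂ : S) (q : ℕ) (r₁ : ℕ) (r₂ : ℕ)
      (_ : IsSigmaMaximiser f (adicOrder f).toNat g₁ g₂ q r₁ r₂ ∧ IsPrimitiveTriple q r₁ r₂),
        flagContactFiltration g₁ g₂ q r₁ r₂ m := by
  unfold jSigmaPtLocal
  rw [if_neg hf0, if_neg hfu]

/-- On a local ring `jSigmaPt R f m = jSigmaPtLocal f m`. [folklore] -/
theorem jSigmaPt_eq (R : Type) [CommRing R] [h : IsLocalRing R] (f : R) (m : ℕ) : jSigmaPt R f m = jSigmaPtLocal f m := by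
  unfold jSigmaPt
  rw [dif_pos h]

/-- Off local rings `jSigmaPt R f m = ⊤` (junk). [folklore] -/
theorem jSigmaPt_of_not_isLocalRing (R : Type) [CommRing R] (h : ¬ IsLocalRing R) (f : R) (m : ℕ) : jSigmaPt R f m = ⊤ := by
  unfold jSigmaPt
  rw [dif_neg h]

/-- The switch at Krull dimension `≤ 2`: `jFlatCore = jContact`. [folklore] -/
theorem jFlatCore_of_dim_le_two (R : Type) [CommRing R] (h : ringKrullDim R ≤ 2) (f : R) (m : ℕ) :
    jFlatCore R f m = jContact R f m := by
  unfold jFlatCore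
  rw [if_pos h]

/-- The switch above Krull dimension `2`: `jFlatCore = jSigmaPt`. [folklore] -/
theorem jFlatCore_of_not_dim_le_two (R : Type) [CommRing R] (h : ¬ ringKrullDim R ≤ 2) (f : R) (m : ℕ) :
    jFlatCore R f m = jSigmaPt R f m := by
  unfold jFlatCore
  rw [if_neg h]

/-- `jFlat` unfolded. [folklore] -/
theorem jFlat_def (R : Type) [CommRing R] (f : R) (m : ℕ) : jFlat R f m = ContactCylinder.jCylinder iotaOrdEps jFlatCore R f m := rfl

/-! ## (adm)-shaped memberships -/

/-- **An attaining flag's filtration lies in the point rule**: for `f ≠ 0` non-unit and a σ-attaining two-flag with primitive weights,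
`flagContactFiltration g₁ g₂ q r₁ r₂ m ≤ jSigmaPt R f m`. [OURS · (o37)] -/
theorem flagContactFiltration_le_jSigmaPt (R : Type) [CommRing R] [IsLocalRing R] {f : R} (hf0 : f ≠ 0) (hfu : ¬ IsUnit f)
    {g₁ g₂ : R} {q r₁ r₂ : ℕ} (hmax : IsSigmaMaximiser f (adicOrder f).toNat g₁ g₂ q r₁ r₂) (hprim : IsPrimitiveTriple q r₁ r₂) (m : ℕ) :
    flagContactFiltration g₁ g₂ q r₁ r₂ m ≤ jSigmaPt R f m := by
  rw [jSigmaPt_eq, jSigmaPtLocal_of_ne hf0 hfu]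
  exact le_iSup_of_le g₁ <| le_iSup_of_le g₂ <| le_iSup_of_le q <| le_iSup_of_le r₁ <| le_iSup_of_le r₂ <|
    le_iSup_of_le ⟨hmax, hprim⟩ le_rfl

/-- **`f` lies in the level-`r₁ν` piece of the point rule** (`ν = ord f`) as soon as it has a σ-attaining two-flag with primitive weights
`(q; r₁, r₂)` — the (adm) membership the (c9′) witness needs. [OURS · (o37)] -/
theorem mem_jSigmaPt_level (R : Type) [CommRing R] [IsLocalRing R] {f : R} (hf0 : f ≠ 0) (hfu : ¬ IsUnit f)
    {g₁ g₂ : R} {q r₁ r₂ : ℕ} (hmax : IsSigmaMaximiser f (adicOrder f).toNat g₁ g₂ q r₁ r₂) (hprim : IsPrimitiveTriple q r₁ r₂) :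
    f ∈ jSigmaPt R f (r₁ * (adicOrder f).toNat) :=
  flagContactFiltration_le_jSigmaPt R hf0 hfu hmax hprim _ hmax.2.2.1

/-! ## Transport of `IsSigmaMaximiser` -/

/-- σ-attainment is transported by ring isomorphisms. [folklore] -/
theorem isSigmaMaximiser_ringEquiv_iff [IsLocalRing S] {T : Type} [CommRing T] [IsLocalRing T] (e : S ≃+* T) (f : S) (ν : ℕ)
    (g₁ g₂ : S) (q r₁ r₂ : ℕ) :
    IsSigmaMaximiser (e f) ν (e g₁) (e g₂) q r₁ r₂ ↔ IsSigmaMaximiser f ν g₁ g₂ q r₁ r₂ := by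
  simp only [IsSigmaMaximiser, isTwoFlag_ringEquiv_iff, apply_mem_flagContactFiltration_iff, flagReaches_ringEquiv_iff]

/-- σ-attainment is invariant under `f ↦ v·f`, `v` a unit. [folklore] -/
theorem isSigmaMaximiser_unit_mul_iff [IsLocalRing S] {v : S} (hv : IsUnit v) (f : S) (ν : ℕ) (g₁ g₂ : S) (q r₁ r₂ : ℕ) :
    IsSigmaMaximiser (v * f) ν g₁ g₂ q r₁ r₂ ↔ IsSigmaMaximiser f ν g₁ g₂ q r₁ r₂ := by
  simp only [IsSigmaMaximiser, Ideal.unit_mul_mem_iff_mem _ hv, flagReaches_unit_mul_iff hv]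

/-! ## Transport of the point rule -/

/-- `jSigmaPtLocal` is transported by ring isomorphisms. [folklore] -/
theorem map_jSigmaPtLocal_ringEquiv [IsLocalRing S] {T : Type} [CommRing T] [IsLocalRing T] (e : S ≃+* T) (f : S) (m : ℕ) :
    (jSigmaPtLocal f m).map e = jSigmaPtLocal (e f) m := by
  by_cases hf0 : f = 0
  · subst hf0
    rw [map_zero, jSigmaPtLocal_zero, jSigmaPtLocal_zero, Ideal.map_bot]
  have hef0 : e f ≠ 0 := e.map_ne_zero_iff.mpr hf0
  by_cases hfu : IsUnit f
  · rw [jSigmaPtLocal_of_isUnit hfu, jSigmaPtLocal_of_isUnit (hfu.map e), Ideal.map_top]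
  have hefu : ¬ IsUnit (e f) := fun h => hfu (by simpa using h.map e.symm)
  rw [jSigmaPtLocal_of_ne hf0 hfu, jSigmaPtLocal_of_ne hef0 hefu, adicOrder_map_ringEquiv]
  apply le_antisymm
  · simp only [Ideal.map_iSup]
    refine iSup_le fun g₁ => iSup_le fun g₂ => iSup_le fun q => iSup_le fun r₁ => iSup_le fun r₂ => iSup_le fun h => ?_
    refine le_iSup_of_le (e g₁) <| le_iSup_of_le (e g₂) <| le_iSup_of_le q <| le_iSup_of_le r₁ <| le_iSup_of_le r₂ <|
      le_iSup_of_le ⟨(isSigmaMaximiser_ringEquiv_iff e f _ g₁ g₂ q r₁ r₂).mpr h.1, h.2⟩ ?_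
    rw [map_flagContactFiltration_ringEquiv]
  · refine iSup_le fun g₁' => iSup_le fun g₂' => iSup_le fun q => iSup_le fun r₁ => iSup_le fun r₂ => iSup_le fun h' => ?_
    have h₁ : IsSigmaMaximiser f (adicOrder f).toNat (e.symm g₁') (e.symm g₂') q r₁ r₂ := by
      rw [← isSigmaMaximiser_ringEquiv_iff e f _ (e.symm g₁') (e.symm g₂') q r₁ r₂, e.apply_symm_apply, e.apply_symm_apply]
      exact h'.1
    rw [Ideal.map_iSup]
    refine le_iSup_of_le (e.symm g₁') ?_
    rw [Ideal.map_iSup]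
    refine le_iSup_of_le (e.symm g₂') ?_
    rw [Ideal.map_iSup]
    refine le_iSup_of_le q ?_
    rw [Ideal.map_iSup]
    refine le_iSup_of_le r₁ ?_
    rw [Ideal.map_iSup]
    refine le_iSup_of_le r₂ ?_
    rw [Ideal.map_iSup]
    refine le_iSup_of_le ⟨h₁, h'.2⟩ ?_
    rw [map_flagContactFiltration_ringEquiv, e.apply_symm_apply, e.apply_symm_apply]

/-- `jSigmaPtLocal` is invariant under `f ↦ v·f`, `v` a unit. [folklore] -/
theorem jSigmaPtLocal_unit_mul [IsLocalRing S] {v : S} (hv : IsUnit v) (f : S) (m : ℕ) :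
    jSigmaPtLocal (v * f) m = jSigmaPtLocal f m := by
  by_cases hf0 : f = 0
  · subst hf0
    rw [mul_zero]
  have hvf0 : v * f ≠ 0 := fun h => hf0 ((hv.mul_right_eq_zero).mp h)
  by_cases hfu : IsUnit f
  · rw [jSigmaPtLocal_of_isUnit hfu, jSigmaPtLocal_of_isUnit (hv.mul hfu)]
  have hvfu : ¬ IsUnit (v * f) := fun h => hfu (isUnit_of_mul_isUnit_right h)
  rw [jSigmaPtLocal_of_ne hvf0 hvfu, jSigmaPtLocal_of_ne hf0 hfu, adicOrder_unit_mul_left hv]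
  refine iSup_congr fun g₁ => iSup_congr fun g₂ => iSup_congr fun q => iSup_congr fun r₁ => iSup_congr fun r₂ => ?_
  exact iSup_congr_Prop (by rw [isSigmaMaximiser_unit_mul_iff hv]) fun _ => rfl

/-- **(c5-shape) `jSigmaPt` is iso-invariant.** [OURS · (o37)] -/
theorem jSigmaPt_isoInvariant : JIsoInvariant jSigmaPt := by
  intro R T _ _ e g m
  by_cases hR : IsLocalRing R
  · haveI : IsLocalRing T := e.isLocalRing
    rw [jSigmaPt_eq, jSigmaPt_eq, map_jSigmaPtLocal_ringEquiv]
  · have hT : ¬ IsLocalRing T := fun hT => hR e.symm.isLocalRing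
    rw [jSigmaPt_of_not_isLocalRing R hR, jSigmaPt_of_not_isLocalRing T hT, Ideal.map_top]

/-- **(c12-J-shape) `jSigmaPt` is unit-invariant.** [OURS · (o37)] -/
theorem jSigmaPt_unitInvariant : JUnitInvariant jSigmaPt := by
  intro R _ v g m hv
  by_cases hR : IsLocalRing R
  · rw [jSigmaPt_eq, jSigmaPt_eq, jSigmaPtLocal_unit_mul hv]
  · rw [jSigmaPt_of_not_isLocalRing R hR, jSigmaPt_of_not_isLocalRing R hR]

/-! ## Transport of the dimension switch and of `jFlat` -/

/-- **`jFlatCore` is iso-invariant** (Krull dimension is an iso-invariant; both branches are). [OURS · (o37)] -/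
theorem jFlatCore_isoInvariant : JIsoInvariant jFlatCore := by
  intro R T _ _ e g m
  have hdim : ringKrullDim R = ringKrullDim T := RingEquiv.ringKrullDim e
  by_cases h : ringKrullDim R ≤ 2
  · have h' : ringKrullDim T ≤ 2 := hdim ▸ h
    rw [jFlatCore_of_dim_le_two R h, jFlatCore_of_dim_le_two T h', jContact_isoInvariant R T e g m]
  · have h' : ¬ ringKrullDim T ≤ 2 := hdim ▸ h
    rw [jFlatCore_of_not_dim_le_two R h, jFlatCore_of_not_dim_le_two T h', jSigmaPt_isoInvariant R T e g m]

/-- **`jFlatCore` is unit-invariant.** [OURS · (o37)] -/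
theorem jFlatCore_unitInvariant : JUnitInvariant jFlatCore := by
  intro R _ v g m hv
  by_cases h : ringKrullDim R ≤ 2
  · rw [jFlatCore_of_dim_le_two R h, jFlatCore_of_dim_le_two R h, jContact_unitInvariant R v g m hv]
  · rw [jFlatCore_of_not_dim_le_two R h, jFlatCore_of_not_dim_le_two R h, jSigmaPt_unitInvariant R v g m hv]

/-- **(c5) OF THE P3 PAIR: `JIsoInvariant jFlat`** (res-type-061's `jCylinder_isoInvariant` p527090 ∘ `iotaOrdEps_isoInvariant` ∘
`jFlatCore_isoInvariant`). [OURS · (o37)] -/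
theorem jFlat_isoInvariant : JIsoInvariant jFlat :=
  ContactCylinder.jCylinder_isoInvariant iotaOrdEps jFlatCore iotaOrdEps_isoInvariant jFlatCore_isoInvariant

/-- **(c12-J) OF THE P3 PAIR: `JUnitInvariant jFlat`** (`jCylinder_unitInvariant` ∘ `iotaOrdEps_unitInvariant` ∘ `jFlatCore_unitInvariant`).
[OURS · (o37)] -/
theorem jFlat_unitInvariant : JUnitInvariant jFlat :=
  ContactCylinder.jCylinder_unitInvariant iotaOrdEps jFlatCore iotaOrdEps_unitInvariant jFlatCore_unitInvariant

/-! ## The three regimes (IOTA3-DESIGN v1.2 §3) -/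

/-- **The value when the top `(ν;ε)`-stratum is `V(P)`**: `jFlat R f m = (jFlatCore (R_P) (f/1) m) ∩ R` (005's `jCylinder_eq_of_topStratum_eq`).
[OURS · (o37)] -/
theorem jFlat_eq_of_topStratum_eq (R : Type) [CommRing R] (f : R) (m : ℕ) {P : Ideal R} [P.IsPrime]
    (hE : ContactCylinder.topStratum iotaOrdEps R f = {𝔮 | P ≤ 𝔮.asIdeal}) :
    jFlat R f m = (jFlatCore (Localization.AtPrime P) (algebraMap R (Localization.AtPrime P) f) m).comap
      (algebraMap R (Localization.AtPrime P)) :=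
  ContactCylinder.jCylinder_eq_of_topStratum_eq iotaOrdEps jFlatCore R f m hE

/-- **P3a / DIVISORIAL regime**: when the top `(ν;ε)`-stratum is `V(P)` with `dim R_P ≤ 2`, `jFlat` IS THE CYLINDER OVER THE P2 RULE:
`jFlat R f m = cylinderAt jContact R P f m = (jContact (R_P) (f/1) m) ∩ R`. [OURS · (o37)] -/
theorem jFlat_eq_cylinderAt_jContact (R : Type) [CommRing R] (f : R) (m : ℕ) {P : Ideal R} [P.IsPrime]
    (hE : ContactCylinder.topStratum iotaOrdEps R f = {𝔮 | P ≤ 𝔮.asIdeal}) (hdim : ringKrullDim (Localization.AtPrime P) ≤ 2) :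
    jFlat R f m = ContactCylinder.cylinderAt jContact R P f m := by
  rw [jFlat_eq_of_topStratum_eq R f m hE, jFlatCore_of_dim_le_two _ hdim, ContactCylinder.cylinderAt_def]

/-- **POINT-CENTRE regime, raw form**: when the generic prime of the top `(ν;ε)`-stratum of a local ring is `𝔪`, `jFlat R f m = jFlatCore R f m`
(005's `jCylinder_of_topStratumPrime_eq_maximalIdeal` with `jFlatCore_isoInvariant`). [OURS · (o37)] -/
theorem jFlat_eq_jFlatCore (R : Type) [CommRing R] [IsLocalRing R] (f : R) (m : ℕ)
    (h : ContactCylinder.topStratumPrime iotaOrdEps R f = maximalIdeal R) : jFlat R f m = jFlatCore R f m :=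
  ContactCylinder.jCylinder_of_topStratumPrime_eq_maximalIdeal iotaOrdEps jFlatCore_isoInvariant R f m h

/-- **POINT-CENTRE regime in dimension 3** (isolated or crossing top point, `dim R > 2`): `jFlat R f m = jSigmaPt R f m` — the exact-flag-weight
centre. [OURS · (o37)] -/
theorem jFlat_eq_jSigmaPt (R : Type) [CommRing R] [IsLocalRing R] (f : R) (m : ℕ)
    (h : ContactCylinder.topStratumPrime iotaOrdEps R f = maximalIdeal R) (hdim : ¬ ringKrullDim R ≤ 2) :
    jFlat R f m = jSigmaPt R f m := by
  rw [jFlat_eq_jFlatCore R f m h, jFlatCore_of_not_dim_le_two R hdim]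

/-- **LOW-DIMENSION regime** (point-centre positions of Krull dimension `≤ 2`): `jFlat R f m = jContact R f m` — the P2 rule of record, so
that every P≤2 theorem about `jContact` at such positions is a theorem about `jFlat`. [OURS · (o37)] -/
theorem jFlat_eq_jContact (R : Type) [CommRing R] [IsLocalRing R] (f : R) (m : ℕ)
    (h : ContactCylinder.topStratumPrime iotaOrdEps R f = maximalIdeal R) (hdim : ringKrullDim R ≤ 2) :
    jFlat R f m = jContact R f m := by
  rw [jFlat_eq_jFlatCore R f m h, jFlatCore_of_dim_le_two R hdim]

/-- The point rule's pieces in `jFlat` at a dimension-3 point-centre position: an attaining flag's filtration lies in `jFlat`.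
[OURS · (o37)] -/
theorem flagContactFiltration_le_jFlat (R : Type) [CommRing R] [IsLocalRing R] {f : R} (hf0 : f ≠ 0) (hfu : ¬ IsUnit f)
    (h : ContactCylinder.topStratumPrime iotaOrdEps R f = maximalIdeal R) (hdim : ¬ ringKrullDim R ≤ 2)
    {g₁ g₂ : R} {q r₁ r₂ : ℕ} (hmax : IsSigmaMaximiser f (adicOrder f).toNat g₁ g₂ q r₁ r₂) (hprim : IsPrimitiveTriple q r₁ r₂) (m : ℕ) :
    flagContactFiltration g₁ g₂ q r₁ r₂ m ≤ jFlat R f m := by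
  rw [jFlat_eq_jSigmaPt R f m h hdim]
  exact flagContactFiltration_le_jSigmaPt R hf0 hfu hmax hprim m

end Iota3

end Summit.ResolutionOfSingularities.ResolutionOfSingularities.Cruxes.HypersurfaceCentreConstruction.LocalEngine

end
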